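import Mathlib
import Literature.NumberTheory.Automorphic.GaloisActionPlaces
import Literature.NumberTheory.Automorphic.AutomorphicInductionUnitaryCharacterCubicResolventDescent
import Literature.NumberTheory.Automorphic.QuadraticHeckeCharacter
import Literature.NumberTheory.GaloisRepresentations.ArtinNormSubgroup
import Literature.NumberTheory.GaloisRepresentations.ArtinFormalismInductionProofs
import Literature.NumberTheory.QuadraticForms.HilbertReciprocityInputsProofs
import Literature.NumberTheory.QuadraticForms.HilbertSymbolNonDyadic
import Summits.Langlands.Langlands.Theorems.PicardMuOrdinaryResidualAutomorphyEvenQuarticDisc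
import Summits.Langlands.Langlands.Theorems.PicardMuOrdinaryResidualAutomorphyEvenPlaces

/-!
# The quadratic character `ε = ω_{E(√δ)/E}` at the places of `E` above `v` (Stage D2b)

Helper file for item stmt-Langlands-13760 (route `PicardMuOrdinary`).  With the notation of the
`Places` file (`K ⊆ E ⊆ M`, `G = Gal(M/K)`, `W ∣ v` a prime of `𝓞 M`, `g` an arithmetic Frobenius
at `W`), let `ε = quadraticHeckeChar E δ` be the quadratic Hecke character of `E` cut out by
`δ = s²` (`s = Σ ± a₄ rᵢ`, `Tower` file), i.e. by the quadratic extension `M^{V} / E` where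
`V ⊆ H` is the kernel of the block sign.  We prove:

* `stabilizer_eq_zpowers` — at an unramified `v` the decomposition group `D_W` is `⟨g⟩`
  (`#D_W = f(W|v)`, `g ∈ D_W`, `g^{f} = 1`, and `f ∣ ord g` from the residue field);
* `valueAtUniformizer_placeOf` — **`ε(ϖ_w) = blockSign (g^{t}) p`** for `w = placeOf p`,
  `t = period (perm4 g) p = f(w|v)`: the Frobenius of `σ_p W` over `w` is `σ_p g^t σ_p⁻¹`, which
  multiplies `s` by the block sign (`smul_sElt`, `blockSign_conj`); so `s̄ ^ {#k_w} = ± s̄` in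
  `𝓞 M / σ_p W`, i.e. `δ` is a square mod `w` iff the sign is `+1`; and `ε(ϖ_w) = ±1` according as
  `δ ∈ E_w²` or not (O'Meara 63:12 / 65:21 / 71:17, all theorems of the tree:
  `valueAtUniformizer_quadraticHeckeChar_of_isSquare`, `_of_not_le`,
  `range_localUnits_not_le_of_not_isSquare_adicCompletion`, Hensel
  `isSquare_algebraMap_adicCompletion_iff`).

Finally (`finprod_placesOver_eq_inducedPoly`, Stage C5) the places of `E` above `v` are the `placeOf p`
for `p` running over orbit representatives (`placesOver_eq_image`, `placeOf_injOn`), so that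
`∏_{w ∣ v} (X^{f(w|v)} - ε(ϖ_w)) = inducedPoly (perm4 g)` in `ℂ[X]` — the induced local factor of the
block-sign character at the Frobenius (pairing file).  Unconditional (no named facts).
-/

set_option linter.dupNamespace false -- project-wide option (lakefile weak.linter.dupNamespace); `Summit.Langlands.Langlands` is the mandated namespace

noncomputable section

namespace Summit.Langlands.Langlands.Theorems.ResidualAutomorphyEven

open Polynomial Equiv Finset NumberField Pairing IsDedekindDomain
open Literature.NumberTheory.GaloisRepresentations Literature.NumberTheory.Automorphic
  Literature.NumberTheory.QuadraticForms
open scoped Classical Pointwise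

variable {f : ℤ[X]} (h : IsSepQuartic f)

/-! ### The decomposition group at an unramified prime is generated by the Frobenius -/

section Frobenius

variable (W : Ideal (𝓞 (M f))) [W.IsMaximal] (v : HeightOneSpectrum (𝓞 K)) (hv : v.asIdeal = W.under (𝓞 K))

/-- `W ≠ ⊥`. -/
theorem W_ne_bot : W ≠ ⊥ := fun h0 =>
  Ring.ne_bot_of_isMaximal_of_not_isField inferInstance (RingOfIntegers.not_isField (M f)) h0

/-- The place of `M` defined by the maximal ideal `W`. -/
def placeW : HeightOneSpectrum (𝓞 (M f)) := ⟨W, Ideal.IsMaximal.isPrime inferInstance, W_ne_bot W⟩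

include hv in
/-- **`D_W = ⟨g⟩` for an arithmetic Frobenius `g` at a prime `W` above an unramified `v`** of the
Galois extension `M/K`: `g ∈ D_W`, `#D_W = f(W|v)` (`card_stabilizer_eq_inertiaDeg`), `g^{f(W|v)} = 1`
(`pow_inertiaDeg_eq_one_of_isArithFrobAt`) and `f(W|v) ∣ ord g` (`g^{ord g} = 1` acts as
`x ↦ x^{q^{ord g}}` on `𝓞 M / W`, `inertiaDeg_dvd_of_forall_pow_residueCard_pow_eq`). -/
theorem stabilizer_eq_zpowers (hG : IsGalois K (M f)) (hunr : Algebra.IsUnramifiedIn (𝓞 (M f)) v.asIdeal)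
    {g : G f} (hg : IsArithFrobAt (𝓞 K) g W) :
    MulAction.stabilizer (G f) W = Subgroup.zpowers g := by
  haveI := hG
  have hPv : (placeW W).asIdeal.under (𝓞 K) = v.asIdeal := hv.symm
  have hcard : Nat.card (MulAction.stabilizer (G f) W) = W.inertiaDeg (𝓞 K) := by
    have h1 := Literature.NumberTheory.Automorphic.HeightOneSpectrum.card_stabilizer_eq_inertiaDeg
      (F := K) (L := M f) (W := placeW W) hPv hunr
    rwa [Literature.NumberTheory.Automorphic.HeightOneSpectrum.stabilizer_eq_stabilizer_asIdeal] at h1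
  have hle : Subgroup.zpowers g ≤ MulAction.stabilizer (G f) W := by
    rw [Subgroup.zpowers_le]
    exact hg.mem_stabilizer
  have hWv : W ∈ v.asIdeal.primesOver (𝓞 (M f)) := ⟨inferInstance, ⟨hv⟩⟩
  have h1 : g ^ W.inertiaDeg (𝓞 K) = 1 := pow_inertiaDeg_eq_one_of_isArithFrobAt hunr hWv hg
  have h2 : W.inertiaDeg (𝓞 K) ∣ orderOf g := by
    refine inertiaDeg_dvd_of_forall_pow_residueCard_pow_eq (v := v) (w := placeW W) hPv fun x => ?_
    obtain ⟨y, rfl⟩ := Ideal.Quotient.mk_surjective x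
    have h3 := pow_smul_sub_pow_mem_of_isArithFrobAt_ringOfIntegers hg (orderOf g) y
    rw [pow_orderOf_eq_one, one_smul, ← hv, ← HeightOneSpectrum.residueCard_eq_card_quotient] at h3
    rw [← map_pow, eq_comm, Ideal.Quotient.eq]
    exact h3
  have horder : orderOf g = W.inertiaDeg (𝓞 K) := Nat.dvd_antisymm (orderOf_dvd_of_pow_eq_one h1) h2
  symm
  apply Subgroup.eq_of_le_of_card_ge hle
  rw [hcard, Nat.card_zpowers, horder]

end Frobenius

/-! ### The block sign under conjugation; `s` as an algebraic integer -/

/-- **Conjugation invariance of the block sign**: for `τ` fixing the pairing `p = σ⁻¹ · 0`,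
`blockSign (σ τ σ⁻¹) 0 = blockSign τ p` (a finite check on `S₄`). -/
theorem blockSign_conj : ∀ (σ τ : Perm (Fin 4)), act τ (act σ⁻¹ 0) = act σ⁻¹ 0 →
    blockSign (σ * τ * σ⁻¹) 0 = blockSign τ (act σ⁻¹ 0) := by
  decide +kernel

/-- `s = Σᵢ ±a₄ rᵢ` (`sElt`) as an algebraic integer of `M`. -/
def sInt (h : IsSepQuartic f) : 𝓞 (M f) := ⟨sElt h, isIntegral_sElt h⟩

/-- Coercion of `sInt`. -/
@[simp] theorem coe_sInt : (sInt h : M f) = sElt h := rfl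

/-- `δ ↦ s²` under `𝓞 E → 𝓞 M`. -/
theorem algebraMap_deltaInt : algebraMap (𝓞 (E h)) (𝓞 (M f)) (deltaInt h) = sInt h ^ 2 := by
  apply RingOfIntegers.ext
  show ((deltaE h : E h) : M f) = ((sInt h ^ 2 : 𝓞 (M f)) : M f)
  rw [RingOfIntegers.coe_eq_algebraMap, map_pow, ← RingOfIntegers.coe_eq_algebraMap, coe_sInt]
  rfl

/-- The action of `G` on `sInt` is the Galois action on `s`. -/
theorem coe_smul_sInt (τ : G f) : ((τ • sInt h : 𝓞 (M f)) : M f) = τ (sElt h) :=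
  Literature.NumberTheory.Automorphic.RingOfIntegers.coe_algEquiv_smul K τ (sInt h)

/-! ### `ε(ϖ_w)` at `w = placeOf p` -/

section Value

attribute [local instance] Ideal.Quotient.field

variable (h12 : 12 ∣ Nat.card (G f)) (W : Ideal (𝓞 (M f))) [W.IsMaximal] (v : HeightOneSpectrum (𝓞 K))
  (hv : v.asIdeal = W.under (𝓞 K))

/-- The quadratic Hecke character `ε = ω_{E(√δ)/E}` of the cubic resolvent field `E`. -/
def eps (h12 : 12 ∣ Nat.card (G f)) (hlc : f.leadingCoeff ≠ 0) : HeckeCharacter (E h) :=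
  quadraticHeckeChar (E h) (deltaInt h) (not_isSquare_deltaE h h12 hlc)

/-- `ε` has finite order (it is quadratic). -/
theorem isFiniteOrder_eps (hlc : f.leadingCoeff ≠ 0) : (eps h h12 hlc).IsFiniteOrder :=
  isFiniteOrder_quadraticHeckeChar _

/-- **The conjugate Frobenius power multiplies `s` by the block sign**: for `σ = σ_p` and
`t = period (perm4 g) p`, `(σ g σ⁻¹)^t = σ g^t σ⁻¹` fixes the pairing `0` and
`(σ g^t σ⁻¹) s = blockSign (g^t) p · s` (`smul_sElt`, `blockSign_conj`). -/
theorem coe_conj_pow_smul_sInt (g : G f) (p : Pairing) :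
    ((((sigmaP h h12 p * g * (sigmaP h h12 p)⁻¹) ^ period (perm4 h g) p) • sInt h : 𝓞 (M f)) : M f) =
      ((blockSign ((perm4 h g) ^ period (perm4 h g) p) p : ℤ) : M f) * sElt h := by
  have hp : act (perm4 h (sigmaP h h12 p))⁻¹ 0 = p := by rw [← map_inv]; exact act_sigmaP_inv h h12 p
  have hτ : act ((perm4 h g) ^ period (perm4 h g) p) (act (perm4 h (sigmaP h h12 p))⁻¹ 0) =
      act (perm4 h (sigmaP h h12 p))⁻¹ 0 := by rw [hp]; exact act_pow_period _ _
  have hfix : act (perm4 h (sigmaP h h12 p * g ^ period (perm4 h g) p * (sigmaP h h12 p)⁻¹)) 0 = 0 := by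
    rw [map_mul, map_mul, act_mul, act_mul, map_inv, map_pow, hτ, hp, act_sigmaP]
  have hsign : blockSign (perm4 h (sigmaP h h12 p * g ^ period (perm4 h g) p * (sigmaP h h12 p)⁻¹)) 0 =
      blockSign ((perm4 h g) ^ period (perm4 h g) p) p := by
    rw [map_mul, map_mul, map_inv, map_pow, blockSign_conj _ _ hτ, hp]
  rw [conj_pow, coe_smul_sInt, smul_sElt h hfix, hsign]

/-- The residue map `k_w = 𝓞 E / w → 𝓞 M / σ_p W` at `w = placeOf p`. -/
def iotaE (p : Pairing) : 𝓞 (E h) ⧸ (placeOf h h12 W v hv p).asIdeal →+* 𝓞 (M f) ⧸ sigmaP h h12 p • W :=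
  Ideal.quotientMap (sigmaP h h12 p • W) (algebraMap (𝓞 (E h)) (𝓞 (M f))) le_rfl

/-- `iotaE` on representatives. -/
theorem iotaE_mk (p : Pairing) (x : 𝓞 (E h)) :
    iotaE h h12 W v hv p (Ideal.Quotient.mk _ x) = Ideal.Quotient.mk _ (algebraMap (𝓞 (E h)) (𝓞 (M f)) x) := by
  rw [iotaE, Ideal.quotientMap_mk]

omit [W.IsMaximal] in
/-- `2 ∉ σ_p W` when `2 ∉ W`. -/
theorem two_not_mem_smul (p : Pairing) (h2 : (2 : 𝓞 (M f)) ∉ W) : (2 : 𝓞 (M f)) ∉ sigmaP h h12 p • W := by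
  have h22 : (sigmaP h h12 p)⁻¹ • (2 : 𝓞 (M f)) = 2 :=
    map_ofNat (MulSemiringAction.toRingHom (G f) (𝓞 (M f)) (sigmaP h h12 p)⁻¹) 2
  rw [Ideal.mem_pointwise_smul_iff_inv_smul_mem, h22]; exact h2

/-- `2 ∉ placeOf p` when `2 ∉ W`. -/
theorem two_not_mem_placeOf (p : Pairing) (h2 : (2 : 𝓞 (M f)) ∉ W) :
    (2 : 𝓞 (E h)) ∉ (placeOf h h12 W v hv p).asIdeal := by
  show (2 : 𝓞 (E h)) ∉ (sigmaP h h12 p • W).under (𝓞 (E h))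
  rw [Ideal.under_def, Ideal.mem_comap, map_ofNat]; exact two_not_mem_smul h h12 W p h2

omit [W.IsMaximal] in
/-- `s ∉ σ_p W` when no conjugate of `s` lies in `W`. -/
theorem sInt_not_mem_smul (p : Pairing) (hs : ∀ τ : G f, τ • sInt h ∉ W) : sInt h ∉ sigmaP h h12 p • W := by
  rw [Ideal.mem_pointwise_smul_iff_inv_smul_mem]; exact hs _

/-- `δ ∉ placeOf p` when no conjugate of `s` lies in `W` (`δ = s²`, `σ_p W` prime). -/
theorem deltaInt_not_mem_placeOf (p : Pairing) (hs : ∀ τ : G f, τ • sInt h ∉ W) :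
    deltaInt h ∉ (placeOf h h12 W v hv p).asIdeal := by
  show deltaInt h ∉ (sigmaP h h12 p • W).under (𝓞 (E h))
  rw [Ideal.under_def, Ideal.mem_comap, algebraMap_deltaInt, pow_two]
  exact fun hmem => (Ideal.IsPrime.mem_or_mem inferInstance hmem).elim
    (sInt_not_mem_smul h h12 W p hs) (sInt_not_mem_smul h h12 W p hs)

/-- **`ε` is unramified at `placeOf p`** (`placeOf p ∤ 2δ`). -/
theorem isUnramifiedAt_eps_placeOf (hlc : f.leadingCoeff ≠ 0) (p : Pairing) (h2 : (2 : 𝓞 (M f)) ∉ W)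
    (hs : ∀ τ : G f, τ • sInt h ∉ W) : (eps h h12 hlc).IsUnramifiedAt (placeOf h h12 W v hv p) :=
  isUnramifiedAt_quadraticHeckeChar _ (two_not_mem_placeOf h h12 W v hv p h2) (deltaInt_not_mem_placeOf h h12 W v hv p hs)

include hv in
/-- **`ε(ϖ_w) = blockSign (g^t) p` at `w = placeOf p`, `t = period (perm4 g) p`**, for `g` an arithmetic
Frobenius at `W ∣ v`, `v` unramified in `M`, `2 ∉ W` and no conjugate of `s` in `W`.  See the module
docstring for the proof. -/
theorem valueAtUniformizer_placeOf (hG : IsGalois K (M f)) (hunr : Algebra.IsUnramifiedIn (𝓞 (M f)) v.asIdeal)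
    (hlc : f.leadingCoeff ≠ 0) {g : G f} (hg : IsArithFrobAt (𝓞 K) g W) (p : Pairing)
    (h2 : (2 : 𝓞 (M f)) ∉ W) (hs : ∀ τ : G f, τ • sInt h ∉ W) :
    (eps h h12 hlc).valueAtUniformizer (placeOf h h12 W v hv p) =
      ((blockSign ((perm4 h g) ^ period (perm4 h g) p) p : ℤ) : ℂ) := by
  haveI := hG
  have hW' : (sigmaP h h12 p • W).IsMaximal := Ideal.IsPrime.isMaximal inferInstance (smul_ne_bot W _)
  have hwv : (placeOf h h12 W v hv p).asIdeal.under (𝓞 K) = v.asIdeal := by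
    rw [← HeightOneSpectrum.under_asIdeal, placeOf_under]
  -- membership transfer along `σ`
  have h2' : (2 : 𝓞 (M f)) ∉ sigmaP h h12 p • W := two_not_mem_smul h h12 W p h2
  have hs' : sInt h ∉ sigmaP h h12 p • W := sInt_not_mem_smul h h12 W p hs
  have h2w : (2 : 𝓞 (E h)) ∉ (placeOf h h12 W v hv p).asIdeal := two_not_mem_placeOf h h12 W v hv p h2
  have hδw : deltaInt h ∉ (placeOf h h12 W v hv p).asIdeal := deltaInt_not_mem_placeOf h h12 W v hv p hs
  have hθ0 : (deltaInt h : E h) ≠ 0 := fun h0 => hδw (by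
    have : deltaInt h = 0 := RingOfIntegers.ext (by rw [h0]; rfl)
    rw [this]; exact zero_mem _)
  -- Step 1: `f(w|v) = t`
  have hD := stabilizer_eq_zpowers W v hv hG hunr hg
  have hf := inertiaDeg_placeOf h h12 W v hv hG hunr g hD p
  -- Step 2: `#k_w = q ^ t`
  have hkw : Nat.card (𝓞 (E h) ⧸ (placeOf h h12 W v hv p).asIdeal) =
      Nat.card (𝓞 K ⧸ v.asIdeal) ^ period (perm4 h g) p := by
    haveI : (placeOf h h12 W v hv p).asIdeal.LiesOver v.asIdeal := ⟨hwv.symm⟩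
    haveI := v.isMaximal
    haveI := (placeOf h h12 W v hv p).isMaximal
    haveI : Module.Finite (𝓞 K) (𝓞 (E h)) := IsIntegralClosure.finite (𝓞 K) K (E h) (𝓞 (E h))
    have hc := Ideal.cardQuot_pow_inertiaDeg v.asIdeal (placeOf h h12 W v hv p).asIdeal (R := 𝓞 K)
    rw [Submodule.cardQuot_apply, Submodule.cardQuot_apply, hf] at hc
    exact hc.symm
  -- Step 3: the Frobenius congruence for `(σ g σ⁻¹)^t` at `σ W`, on `s`
  have hcongr : ((sigmaP h h12 p * g * (sigmaP h h12 p)⁻¹) ^ period (perm4 h g) p) • sInt h -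
      sInt h ^ Nat.card (𝓞 (E h) ⧸ (placeOf h h12 W v hv p).asIdeal) ∈ sigmaP h h12 p • W := by
    have hc := pow_smul_sub_pow_mem_of_isArithFrobAt_ringOfIntegers (hg.conj (sigmaP h h12 p))
      (period (perm4 h g) p) (sInt h)
    rw [Ideal.under_smul, ← hv, ← hkw] at hc
    exact hc
  have hsmul : ((sigmaP h h12 p * g * (sigmaP h h12 p)⁻¹) ^ period (perm4 h g) p) • sInt h =
      ((blockSign ((perm4 h g) ^ period (perm4 h g) p) p : ℤ) : 𝓞 (M f)) * sInt h := by
    apply RingOfIntegers.ext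
    rw [coe_conj_pow_smul_sInt, RingOfIntegers.coe_eq_algebraMap, map_mul, map_intCast,
      ← RingOfIntegers.coe_eq_algebraMap, coe_sInt]
  -- Step 4: in the residue field `𝓞 M / σ W ⊇ k_w`: `s̄ ^ #k_w = e • s̄`
  haveI : (placeOf h h12 W v hv p).asIdeal.IsMaximal := (placeOf h h12 W v hv p).isMaximal
  haveI : Finite (𝓞 (E h) ⧸ (placeOf h h12 W v hv p).asIdeal) := Ideal.finiteQuotientOfFreeOfNeBot _ (placeOf h h12 W v hv p).ne_bot
  haveI : Finite (𝓞 (M f) ⧸ sigmaP h h12 p • W) := Ideal.finiteQuotientOfFreeOfNeBot _ (smul_ne_bot W _)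
  have hsbar0 : Ideal.Quotient.mk (sigmaP h h12 p • W) (sInt h) ≠ 0 := fun h0 =>
    hs' (Ideal.Quotient.eq_zero_iff_mem.mp h0)
  have h20 : (2 : 𝓞 (M f) ⧸ sigmaP h h12 p • W) ≠ 0 := fun h0 => h2' (by
    rw [← Ideal.Quotient.eq_zero_iff_mem, map_ofNat]; exact h0)
  have hpow : Ideal.Quotient.mk (sigmaP h h12 p • W) (sInt h) ^ Nat.card (𝓞 (E h) ⧸ (placeOf h h12 W v hv p).asIdeal) =
      ((blockSign ((perm4 h g) ^ period (perm4 h g) p) p : ℤ) : 𝓞 (M f) ⧸ sigmaP h h12 p • W) *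
        Ideal.Quotient.mk (sigmaP h h12 p • W) (sInt h) := by
    rw [← map_intCast (Ideal.Quotient.mk (sigmaP h h12 p • W)), ← map_mul, ← hsmul, eq_comm, ← sub_eq_zero,
      ← map_pow, ← map_sub, Ideal.Quotient.eq_zero_iff_mem]
    exact hcongr
  have hιδ : iotaE h h12 W v hv p (Ideal.Quotient.mk _ (deltaInt h)) =
      Ideal.Quotient.mk (sigmaP h h12 p • W) (sInt h) ^ 2 := by
    rw [iotaE_mk, algebraMap_deltaInt, map_pow]
  -- Step 5: the two cases `e = ±1`
  rcases blockSign_eq_one_or ((perm4 h g) ^ period (perm4 h g) p) p with he1 | he1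
  · -- `e = 1`: `s̄ ∈ k_w`, so `δ̄ = s̄²` is a square in `k_w`, `δ ∈ E_w²`, `ε(ϖ_w) = 1`
    rw [he1, Int.cast_one]
    have hmem : Ideal.Quotient.mk (sigmaP h h12 p • W) (sInt h) ∈ Set.range (iotaE h h12 W v hv p) := by
      rw [FiniteField.mem_range_iff_pow_card_eq, hpow, he1, Int.cast_one, one_mul]
    obtain ⟨y, hy⟩ := hmem
    have hsq : IsSquare (Ideal.Quotient.mk (placeOf h h12 W v hv p).asIdeal (deltaInt h)) := by
      refine ⟨y, RingHom.injective (iotaE h h12 W v hv p) ?_⟩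
      rw [hιδ, map_mul, hy, pow_two]
    have hsq' : IsSquare (algebraMap (E h) ((placeOf h h12 W v hv p).adicCompletion (E h)) (deltaInt h : E h)) := by
      -- `algebraMap (𝓞 E) E_w = algebraMap E E_w ∘ (↑)` definitionally
      exact (isSquare_algebraMap_adicCompletion_iff (E h) (placeOf h h12 W v hv p) h2w hδw).mpr hsq
    exact valueAtUniformizer_quadraticHeckeChar_of_isSquare _ hsq'
  · -- `e = -1`: `s̄ ^ #k_w = -s̄ ≠ s̄`, so `δ̄` is not a square in `k_w`, `δ ∉ E_w²`, `ε(ϖ_w) = -1`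
    rw [he1, Int.cast_neg, Int.cast_one]
    have hnsq : ¬ IsSquare (Ideal.Quotient.mk (placeOf h h12 W v hv p).asIdeal (deltaInt h)) := by
      rintro ⟨y, hy⟩
      have hy2 : (iotaE h h12 W v hv p y) ^ 2 = Ideal.Quotient.mk (sigmaP h h12 p • W) (sInt h) ^ 2 := by
        rw [← hιδ, hy, map_mul, pow_two]
      have hmem : Ideal.Quotient.mk (sigmaP h h12 p • W) (sInt h) ∈ Set.range (iotaE h h12 W v hv p) := by
        rcases eq_or_eq_neg_of_sq_eq_sq _ _ hy2 with h1 | h1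
        · exact ⟨y, h1⟩
        · exact ⟨-y, by rw [map_neg, h1, neg_neg]⟩
      rw [FiniteField.mem_range_iff_pow_card_eq, hpow, he1, Int.cast_neg, Int.cast_one, neg_one_mul,
        neg_eq_iff_add_eq_zero, ← two_mul, mul_eq_zero] at hmem
      exact hmem.elim h20 hsbar0
    have hnsq' : ¬ IsSquare (algebraMap (E h) ((placeOf h h12 W v hv p).adicCompletion (E h)) (deltaInt h : E h)) := by
      intro hsq
      exact hnsq ((isSquare_algebraMap_adicCompletion_iff (E h) (placeOf h h12 W v hv p) h2w hδw).mp hsq)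
    exact valueAtUniformizer_quadraticHeckeChar_of_not_le _ h2w hδw
      (range_localUnits_not_le_of_not_isSquare_adicCompletion (E h) hθ0 _ hnsq')

end Value

/-! ### The induced local factor at `v`: product over the places of `E` above `v` (Stage C5) -/

section LocalFactor

variable (h12 : 12 ∣ Nat.card (G f)) (W : Ideal (𝓞 (M f))) [W.IsMaximal] (v : HeightOneSpectrum (𝓞 K))
  (hv : v.asIdeal = W.under (𝓞 K))

/-- Every `⟨τ⟩`-orbit on the pairings contains a representative (`isRep`: its least element). -/
theorem exists_isRep_mem_orbitFinset : ∀ (τ : Perm (Fin 4)) (p : Pairing),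
    ∃ q ∈ orbitFinset τ p, isRep τ q = true := by
  decide +kernel

/-- Two representatives in the same orbit coincide. -/
theorem eq_of_isRep_of_mem_orbitFinset : ∀ (τ : Perm (Fin 4)) (p q : Pairing),
    isRep τ p = true → isRep τ q = true → q ∈ orbitFinset τ p → p = q := by
  decide +kernel

/-- The orbit relation is symmetric. -/
theorem mem_orbitFinset_symm : ∀ (τ : Perm (Fin 4)) (p q : Pairing),
    q ∈ orbitFinset τ p → p ∈ orbitFinset τ q := by
  decide +kernel

/-- **Fibres of `placeOf` are the `⟨g⟩`-orbits** when `D_W = ⟨g⟩`. -/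
theorem placeOf_eq_placeOf_iff_mem_orbitFinset (hG : IsGalois K (M f)) {g : G f}
    (hD : MulAction.stabilizer (G f) W = Subgroup.zpowers g) (p q : Pairing) :
    placeOf h h12 W v hv p = placeOf h h12 W v hv q ↔ q ∈ orbitFinset (perm4 h g) p := by
  rw [placeOf_eq_placeOf_iff h h12 (W := W) (v := v) (hv := hv) hG p q]
  constructor
  · rintro ⟨d, hdW, rfl⟩
    have hd : d ∈ Subgroup.zpowers g := by rw [← hD]; exact hdW
    obtain ⟨k, rfl⟩ := Subgroup.mem_zpowers_iff.mp hd
    rw [map_zpow]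
    exact act_zpow_mem_orbitFinset _ _ _
  · intro hq
    have hstab : ∀ d ∈ Subgroup.zpowers g, d • W = W := fun d hd => by
      rw [← hD] at hd; exact hd
    rw [orbitFinset, Finset.mem_insert, Finset.mem_insert, Finset.mem_singleton] at hq
    rcases hq with rfl | rfl | rfl
    · exact ⟨1, one_smul _ _, by rw [map_one, act_one]⟩
    · exact ⟨g, hstab g (Subgroup.mem_zpowers g), rfl⟩
    · exact ⟨g * g, hstab _ (Subgroup.mul_mem _ (Subgroup.mem_zpowers g) (Subgroup.mem_zpowers g)),
        by rw [map_mul, act_mul]⟩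

/-- The finset of orbit representatives of `⟨τ⟩` on the pairings. -/
def repFinset (τ : Perm (Fin 4)) : Finset Pairing := Finset.univ.filter fun p : Pairing => isRep τ p

/-- **The places of `E` above `v` are the `placeOf p`, `p` an orbit representative** (bijectively). -/
theorem placesOver_eq_image (hG : IsGalois K (M f)) {g : G f}
    (hD : MulAction.stabilizer (G f) W = Subgroup.zpowers g) :
    {w : HeightOneSpectrum (𝓞 (E h)) | w.under (𝓞 K) = v} =
      ↑((repFinset (perm4 h g)).image (placeOf h h12 W v hv)) := by
  ext w
  rw [Set.mem_setOf_eq, Finset.coe_image, Set.mem_image]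
  constructor
  · intro hw
    obtain ⟨p, rfl⟩ := exists_placeOf_eq h h12 (W := W) (hv := hv) hG hw
    obtain ⟨q, hq, hrep⟩ := exists_isRep_mem_orbitFinset (perm4 h g) p
    refine ⟨q, ?_, ((placeOf_eq_placeOf_iff_mem_orbitFinset h h12 W v hv hG hD p q).mpr hq).symm⟩
    rw [Finset.mem_coe, repFinset, Finset.mem_filter]
    exact ⟨Finset.mem_univ _, hrep⟩
  · rintro ⟨p, -, rfl⟩
    exact placeOf_under h h12 W v hv p

/-- `placeOf` is injective on orbit representatives. -/
theorem placeOf_injOn (hG : IsGalois K (M f)) {g : G f}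
    (hD : MulAction.stabilizer (G f) W = Subgroup.zpowers g) :
    Set.InjOn (placeOf h h12 W v hv) ↑(repFinset (perm4 h g)) := by
  intro p hp q hq hpq
  rw [Finset.mem_coe, repFinset, Finset.mem_filter] at hp hq
  exact eq_of_isRep_of_mem_orbitFinset _ p q hp.2 hq.2
    ((placeOf_eq_placeOf_iff_mem_orbitFinset h h12 W v hv hG hD p q).mp hpq)

/-- The induced local factor over `ℂ` as a product over orbit representatives. -/
theorem map_inducedPoly (τ : Perm (Fin 4)) :
    (inducedPoly τ).map (Int.castRingHom ℂ) =
      ∏ p ∈ repFinset τ, (X ^ period τ p - C ((blockSign (τ ^ period τ p) p : ℤ) : ℂ)) := by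
  rw [inducedPoly, dataPoly, inducedData, Polynomial.map_multiset_prod, Multiset.map_map, Multiset.map_map,
    repFinset, Finset.prod_eq_multiset_prod]
  congr 1
  refine Multiset.map_congr rfl fun p _ => ?_
  simp only [Function.comp_apply, Polynomial.map_sub, Polynomial.map_pow, map_X, Polynomial.map_C]
  rfl

include hv in
/-- **C5. The induced local factor of `ε` along `E/K` at a good place `v` is the induced local factor of
the block-sign character at the Frobenius**:
`∏_{w ∣ v} (X^{f(w|v)} - ε(ϖ_w)) = inducedPoly (perm4 g)` (over `ℂ`). -/
theorem finprod_placesOver_eq_inducedPoly (hG : IsGalois K (M f)) (hunr : Algebra.IsUnramifiedIn (𝓞 (M f)) v.asIdeal)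
    (hlc : f.leadingCoeff ≠ 0) {g : G f} (hg : IsArithFrobAt (𝓞 K) g W)
    (h2 : (2 : 𝓞 (M f)) ∉ W) (hs : ∀ τ : G f, τ • sInt h ∉ W) :
    ∏ᶠ w ∈ {w : HeightOneSpectrum (𝓞 (E h)) | w.under (𝓞 K) = v},
        (X ^ w.asIdeal.inertiaDeg (𝓞 K) - C ((eps h h12 hlc).valueAtUniformizer w)) =
      (inducedPoly (perm4 h g)).map (Int.castRingHom ℂ) := by
  have hD := stabilizer_eq_zpowers W v hv hG hunr hg
  rw [placesOver_eq_image h h12 W v hv hG hD, finprod_mem_coe_finset,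
    Finset.prod_image (placeOf_injOn h h12 W v hv hG hD), map_inducedPoly]
  refine Finset.prod_congr rfl fun p _ => ?_
  rw [inertiaDeg_placeOf h h12 W v hv hG hunr g hD p, valueAtUniformizer_placeOf h h12 W v hv hG hunr hlc hg p h2 hs]

end LocalFactor

end Summit.Langlands.Langlands.Theorems.ResidualAutomorphyEven
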